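import Summits.BirchSwinnertonDyer.BirchSwinnertonDyer.Theorems.Rank2ObservatoryRootNumberLocal
import Literature.NumberTheory.DiophantineGeometry.PastenValuationProductsProofs
import Literature.NumberTheory.EllipticCurves.RootNumberAtkinLehnerSemistableProofs
import Mathlib.NumberTheory.LegendreSymbol.JacobiSymbol
import HarnessLib

/-!
# BirchSwinnertonDyer / CountingDoorF2AtThree — crux I2 `RootNumberPlusLowerDensityLargeF2`
# (stmt-BirchSwinnertonDyer-19441), lane «closed-form local root numbers»: the root number of a
# SEMISTABLE INTEGER MODEL in closed form (an explicit signed product over the primes of `Δ`)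

Route `route-BirchSwinnertonDyer-CountingDoorF2AtThree` (cell bsd-rank2, WIDTH-LEVER lane B
`bsd-rank2-rootno-p2`; director-bsd 2026-08-27: «root-number density from the closed-form local root
numbers on the family + a squarefree sieve, independent of any Selmer input»). This file is the
ROUTE-FREE kernel of that lane: for an integer Weierstrass equation `W₀` that is SEMISTABLE in the
elementary sense «no prime divides both `Δ(W₀)` and `c₄(W₀)`» (then `W₀` is minimal with good or
multiplicative reduction at every prime, Silverman *AEC* VII.5.1), the global root number of
`W₀ ⊗ ℚ` is an EXPLICIT arithmetic function of the coefficients: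

* `nodalDisc_eq_neg_c₄_mul_c₆` — the discriminant of the node-tangent quadratic
  `c₄T² + a₁c₄T − (54b₆ − 3b₂b₄ + a₂c₄)` of the observatory file is `−c₄c₆` identically (`ring`); so
  at a multiplicative prime `p` the reduction is split iff `−c₄c₆` (equivalently `−c₆`, as
  `c₄ ≡ (c₆/c₄)²`) is a square mod `p` — Rohrlich's `w_p = −(−c₆ | p)`;
* `localRootNumberAt_eq_neg_jacobiSym` — at an odd prime `p ∣ Δ`, `p ∤ c₄`:
  `w_p = −J(−c₄c₆ | p)`; `localRootNumberAt_two_eq` — at `p = 2 ∣ Δ`, `2 ∤ c₄`: `w₂ = −1` iff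
  `54b₆ − 3b₂b₄ + a₂c₄` is even (the node-tangent quadratic is `T² + T + K` over `𝔽₂`);
* `isSemistable_of_forall_not_dvd`, `squarefree_conductorNorm_of_forall_not_dvd`,
  `not_hasAdditiveReductionAt_of_forall_not_dvd` — such a `W₀ ⊗ ℚ` is semistable, its conductor is
  squarefree, it has no additive place;
* `algebraicRootNumber_eq_neg_prod_primeFactors` — `−∏ᵥ w_v = −∏_{p ∣ Δ} s_p(W₀)` with the explicit
  signs `s_p` above (a finite product over `(|Δ|).primeFactors`);
* `rootNumber_eq_neg_prod_primeFactors` — the ANALYTIC root number equals the same, modulo ONLY the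
  Modularity Theorem `exists_isNewformOf` (through the tree's PROVED
  `rootNumber_eq_algebraicRootNumber_of_squarefree`, Kellock–Dokchitser 2023 Cor. 2.5 / Atkin–Lehner at
  squarefree level) — no Rohrlich/Deligne fact is assumed.

The companion `…SemistableRootNumberSquarefree.lean` shows that a SQUAREFREE `Δ` already forces the
hypothesis and rewrites the product as `−μ(|Δ|)·J(−c₄c₆ | |Δ|)` (Liouville–Jacobi normal form).
So on the semistable locus the root number is (a locally constant sign) × (the Liouville function of
the discriminant) × (a Jacobi symbol): the parity obstruction behind crux I2 made explicit and
kernel-checked. Nothing is asserted beyond the displayed hypothesis `exists_isNewformOf`.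
PARTITION: none — r_an ≥ 2, summit axis S0; TWIN (D-0056): n/a. B1 honesty: local/global root-number
bookkeeping for explicit equations; nothing reads r_an; no S0 motion.

References: D. Rohrlich, *Compositio Math.* 87 (1993) Prop. 2 [Rohrlich1993Compositio]; L. Cowland
Kellock, V. Dokchitser, *Bull. LMS* 55 (2023) Def. 2.1, Cor. 2.5 [KellockDokchitser2023]; J. H.
Silverman, *AEC* 2nd ed. (2009) VII.5 Prop. 5.1, C.16 [SilvermanAEC2009]; H. A. Helfgott,
arXiv:math/0408141 §1 (root number = pliable × λ(M_E)) [Helfgott2004RootNumber].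
-/

set_option linter.dupNamespace false
set_option autoImplicit false

noncomputable section

open scoped Classical NumberTheorySymbols

open IsDedekindDomain Rat.HeightOneSpectrum WeierstrassCurve Polynomial
  Summit.BirchSwinnertonDyer.BirchSwinnertonDyer.Rank2Observatory.RootNumber

namespace Summit.BirchSwinnertonDyer.BirchSwinnertonDyer.Theorems.SemistableRootNumber

variable {W₀ : WeierstrassCurve ℤ}

/-! ### §1 The node-tangent discriminant is `−c₄c₆` -/

/-- **`nodalDisc = −c₄c₆`**: the discriminant `(a₁c₄)² + 4c₄(54b₆ − 3b₂b₄ + a₂c₄)` of the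
node-tangent quadratic equals `−c₄c₆` for every Weierstrass equation (polynomial identity:
`c₄(a₁² + 4a₂) − 12b₂b₄ + 216b₆ = c₄b₂ − 12b₂b₄ + 216b₆ = −c₆`). Hence at a multiplicative prime `p`
(`p ∤ c₄`, so `c₄ ≡ (c₆/c₄)²` is a nonzero square) «split» reads «`−c₆` is a square mod `p`»,
Rohrlich's `w_p = −(−c₆ | p)`. [cite: Rohrlich1993Compositio, Prop. 2(ii)] -/
theorem nodalDisc_eq_neg_c₄_mul_c₆ (W₀ : WeierstrassCurve ℤ) : nodalDisc W₀ = -(W₀.c₄ * W₀.c₆) := by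
  simp only [nodalDisc, WeierstrassCurve.c₄, WeierstrassCurve.c₆, WeierstrassCurve.b₂,
    WeierstrassCurve.b₄, WeierstrassCurve.b₆]
  ring

/-- At a prime `p ∣ Δ` with `p ∤ c₄`, `p ∤ c₄c₆` (from `1728Δ = c₄³ − c₆²`: `p ∣ c₆ ⇒ p ∣ c₄³`).
[cite: SilvermanAEC2009, III.1 (c-relation)] -/
theorem not_dvd_c₄_mul_c₆ {p : ℕ} (hp : p.Prime) (hΔ : (p : ℤ) ∣ W₀.Δ) (hc₄ : ¬ (p : ℤ) ∣ W₀.c₄) :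
    ¬ (p : ℤ) ∣ W₀.c₄ * W₀.c₆ := by
  have hp' : Prime (p : ℤ) := Nat.prime_iff_prime_int.mp hp
  intro h
  rcases hp'.dvd_or_dvd h with h4 | h6
  · exact hc₄ h4
  · have hrel : W₀.c₄ ^ 3 = 1728 * W₀.Δ + W₀.c₆ ^ 2 := by
      have := W₀.c_relation; linear_combination -this
    have : (p : ℤ) ∣ W₀.c₄ ^ 3 := by
      rw [hrel]
      exact dvd_add (dvd_mul_of_dvd_right hΔ _) (dvd_pow h6 two_ne_zero)
    exact hc₄ (hp'.dvd_of_dvd_pow this)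

/-! ### §2 The local signs at the multiplicative primes -/

/-- **`w_p = −J(−c₄c₆ | p)` at an odd multiplicative prime** of the integer equation `W₀`
(`p ∣ Δ`, `p ∤ c₄`): split iff the node-tangent quadratic has a root mod `p` iff its discriminant
`−c₄c₆` is a (nonzero) square mod `p`; Rohrlich 1993 Prop. 2(ii) (`w_p = −1` split, `+1`
non-split). [cite: Rohrlich1993Compositio, Prop. 2(ii)] -/
theorem localRootNumberAt_eq_neg_jacobiSym [(W₀.baseChange ℚ).IsElliptic] {v : HeightOneSpectrum ℤ}
    (hΔ : (natGenerator v : ℤ) ∣ W₀.Δ) (hc₄ : ¬ (natGenerator v : ℤ) ∣ W₀.c₄)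
    (h2 : natGenerator v ≠ 2) :
    (W₀.baseChange ℚ).localRootNumberAt v = -J(-(W₀.c₄ * W₀.c₆) | natGenerator v) := by
  set p := natGenerator v with hp
  haveI hpI : Fact p.Prime := ⟨prime_natGenerator v⟩
  have hd : ¬ (p : ℤ) ∣ nodalDisc W₀ := by
    rw [nodalDisc_eq_neg_c₄_mul_c₆, dvd_neg]
    exact not_dvd_c₄_mul_c₆ hpI.out hΔ hc₄
  have hd0 : ((nodalDisc W₀ : ℤ) : ZMod p) ≠ 0 := by
    rwa [Ne, ZMod.intCast_zmod_eq_zero_iff_dvd]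
  rw [← nodalDisc_eq_neg_c₄_mul_c₆, ← jacobiSym.legendreSym.to_jacobiSym]
  rcases legendreSym.eq_one_or_neg_one p hd0 with h1 | h1
  · -- split: produce a root of the node-tangent quadratic mod `p`
    rw [h1]
    obtain ⟨s, hs⟩ := (legendreSym.eq_one_iff p hd0).mp h1
    have hc₄0 : ((W₀.c₄ : ℤ) : ZMod p) ≠ 0 := by
      rwa [Ne, ZMod.intCast_zmod_eq_zero_iff_dvd]
    have h20 : (2 : ZMod p) ≠ 0 := by
      have h2' : ((2 : ℕ) : ZMod p) ≠ 0 := by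
        rw [Ne, ZMod.natCast_eq_zero_iff]
        intro h
        exact h2 (((Nat.prime_dvd_prime_iff_eq hpI.out Nat.prime_two).mp h))
      exact_mod_cast h2'
    obtain ⟨t₀, hlin⟩ : ∃ t₀ : ZMod p,
        2 * (W₀.c₄ : ZMod p) * t₀ = s - (W₀.a₁ : ZMod p) * (W₀.c₄ : ZMod p) :=
      ⟨(s - (W₀.a₁ : ZMod p) * (W₀.c₄ : ZMod p)) * (2 * (W₀.c₄ : ZMod p))⁻¹, by
        rw [← mul_assoc, mul_comm (2 * (W₀.c₄ : ZMod p)) (s - _), mul_assoc,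
          mul_inv_cancel₀ (mul_ne_zero h20 hc₄0), mul_one]⟩
    have hsq : s * s = ((nodalDisc W₀ : ℤ) : ZMod p) := hs.symm
    simp only [nodalDisc] at hsq
    push_cast at hsq
    have h4 : (4 : ZMod p) * (W₀.c₄ : ZMod p) ≠ 0 := by
      have : (4 : ZMod p) = 2 * 2 := by norm_num
      rw [this]; exact mul_ne_zero (mul_ne_zero h20 h20) hc₄0
    have hkey : (W₀.c₄ : ZMod p) * t₀ ^ 2 + (W₀.a₁ : ZMod p) * (W₀.c₄ : ZMod p) * t₀
        - (54 * (W₀.b₆ : ZMod p) - 3 * (W₀.b₂ : ZMod p) * (W₀.b₄ : ZMod p)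
          + (W₀.a₂ : ZMod p) * (W₀.c₄ : ZMod p)) = 0 := by
      have : (4 : ZMod p) * (W₀.c₄ : ZMod p) * ((W₀.c₄ : ZMod p) * t₀ ^ 2
          + (W₀.a₁ : ZMod p) * (W₀.c₄ : ZMod p) * t₀
          - (54 * (W₀.b₆ : ZMod p) - 3 * (W₀.b₂ : ZMod p) * (W₀.b₄ : ZMod p)
            + (W₀.a₂ : ZMod p) * (W₀.c₄ : ZMod p))) = 0 := by
        linear_combination (2 * (W₀.c₄ : ZMod p) * t₀ + (W₀.a₁ : ZMod p) * (W₀.c₄ : ZMod p) + s) *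
          hlin + hsq
      rcases mul_eq_zero.mp this with h0 | h0
      · exact absurd h0 h4
      · exact h0
    -- lift the root to `ℤ`
    obtain ⟨t, ht⟩ : ∃ t : ℤ, (t : ZMod p) = t₀ := ⟨t₀.cast, by simp⟩
    refine localRootNumberAt_eq_neg_one_of_root hΔ hc₄ (t := t) ?_
    rw [← ZMod.intCast_zmod_eq_zero_iff_dvd]
    push_cast
    rw [ht]
    exact hkey
  · -- non-split: Euler's criterion
    rw [h1, neg_neg]
    refine localRootNumberAt_eq_one_of_pow_eq_neg_one hΔ hc₄ h2 ?_
    have := legendreSym.eq_pow p (nodalDisc W₀)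
    rw [h1] at this
    push_cast at this
    exact this.symm

/-- `2 ∤ c₄(W₀)` iff `a₁` is odd (`c₄ ≡ a₁⁴ (mod 2)`). [folklore] -/
theorem two_dvd_c₄_iff (W₀ : WeierstrassCurve ℤ) : (2 : ℤ) ∣ W₀.c₄ ↔ (2 : ℤ) ∣ W₀.a₁ := by
  have h : W₀.c₄ = W₀.a₁ ^ 4 + 2 * (4 * W₀.a₁ ^ 2 * W₀.a₂ + 8 * W₀.a₂ ^ 2 - 24 * W₀.a₄
      - 12 * W₀.a₁ * W₀.a₃) := by
    simp only [WeierstrassCurve.c₄, WeierstrassCurve.b₂, WeierstrassCurve.b₄]; ring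
  rw [h]
  constructor
  · intro hd
    have : (2 : ℤ) ∣ W₀.a₁ ^ 4 := (dvd_add_left (dvd_mul_right 2 _)).mp hd
    exact Int.prime_two.dvd_of_dvd_pow this
  · intro hd
    exact dvd_add (dvd_pow hd (by norm_num)) (dvd_mul_right 2 _)

/-- In `𝔽₂`, `u² + u = 0` for every `u`. [folklore] -/
private theorem zmod_two_sq_add_self : ∀ u : ZMod 2, u ^ 2 + u = 0 := by decide

/-- **`w₂` at a multiplicative prime `2`** of the integer equation `W₀` (`2 ∣ Δ`, `2 ∤ c₄`, i.e. `a₁`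
odd): over `𝔽₂` the node-tangent quadratic is `T² + T + K`, `K = 54b₆ − 3b₂b₄ + a₂c₄`, which has a
root iff `K` is even; so `w₂ = −1` (split) iff `2 ∣ K`, else `w₂ = +1`.
[cite: Rohrlich1993Compositio, Prop. 2(ii)] [cite: SilvermanAEC2009, VII.5 Prop. 5.1(b)] -/
theorem localRootNumberAt_two_eq [(W₀.baseChange ℚ).IsElliptic] {v : HeightOneSpectrum ℤ}
    (hΔ : (natGenerator v : ℤ) ∣ W₀.Δ) (hc₄ : ¬ (natGenerator v : ℤ) ∣ W₀.c₄)
    (h2 : natGenerator v = 2) :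
    (W₀.baseChange ℚ).localRootNumberAt v =
      if (2 : ℤ) ∣ 54 * W₀.b₆ - 3 * W₀.b₂ * W₀.b₄ + W₀.a₂ * W₀.c₄ then -1 else 1 := by
  split_ifs with hK
  · refine localRootNumberAt_eq_neg_one_of_root hΔ hc₄ (t := 0) ?_
    rw [h2, show W₀.c₄ * (0 : ℤ) ^ 2 + W₀.a₁ * W₀.c₄ * 0
      - (54 * W₀.b₆ - 3 * W₀.b₂ * W₀.b₄ + W₀.a₂ * W₀.c₄)
      = -(54 * W₀.b₆ - 3 * W₀.b₂ * W₀.b₄ + W₀.a₂ * W₀.c₄) by ring, dvd_neg]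
    exact_mod_cast hK
  · haveI : Fact (natGenerator v).Prime := ⟨prime_natGenerator v⟩
    have hm := hasMultiplicativeReductionAt_of_dvd_of_not_dvd hΔ hc₄
    refine WeierstrassCurve.localRootNumber_of_hasMultiplicativeReduction _ _ hm ?_
    change ¬ (W₀.baseChange ℚ).HasSplitMultiplicativeReductionAt v
    rw [hasSplitMultiplicativeReductionAt_iff_splits hΔ hc₄]
    have ha₁ : ¬ (2 : ℤ) ∣ W₀.a₁ := by rw [← two_dvd_c₄_iff]; rwa [h2] at hc₄
    have hc₄2 : ¬ (2 : ℤ) ∣ W₀.c₄ := by rwa [h2] at hc₄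
    -- pass to the concrete prime `2`
    generalize hq : natGenerator v = q at h2 ⊢
    subst h2
    haveI : Fact (Nat.Prime 2) := ⟨Nat.prime_two⟩
    intro hs
    obtain ⟨t, ht⟩ := hs.exists_eval_eq_zero
      (by rw [Rank1Residual.IntModel.degree_nodal_eq_two W₀ 2 (by exact_mod_cast hc₄2)]; decide)
    simp only [eval_sub, eval_add, eval_mul, eval_C, eval_X, eval_pow, map_c₄, map_b₂, map_b₄,
      map_b₆, map_a₁, map_a₂, eq_intCast] at ht
    -- in `ZMod 2`: `c₄ = 1`, `a₁ = 1`, `K = 1`, and `t² + t = 0`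
    have cast_odd : ∀ x : ℤ, ¬ (2 : ℤ) ∣ x → (x : ZMod 2) = 1 := by
      intro x hx
      obtain ⟨k, hk⟩ : ∃ k : ℤ, x = 2 * k + 1 := ⟨x / 2, by omega⟩
      rw [hk]
      push_cast
      rw [show (2 : ZMod 2) = 0 from rfl, zero_mul, zero_add]
    have hc₄' : ((W₀.c₄ : ℤ) : ZMod 2) = 1 := cast_odd _ hc₄2
    have ha₁' : ((W₀.a₁ : ℤ) : ZMod 2) = 1 := cast_odd _ ha₁
    have hK' : ((54 * W₀.b₆ - 3 * W₀.b₂ * W₀.b₄ + W₀.a₂ * W₀.c₄ : ℤ) : ZMod 2) = 1 :=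
      cast_odd _ hK
    have htt : t ^ 2 + t = 0 := zmod_two_sq_add_self t
    push_cast at hK'
    rw [hc₄', ha₁'] at ht
    rw [hc₄'] at hK'
    have h10 : (1 : ZMod 2) = 0 := by
      linear_combination (-1 : ZMod 2) * ht + htt - hK'
    exact one_ne_zero h10

/-! ### §3 Semistability: no prime divides both `Δ` and `c₄` -/

/-- **Semistable at every place** when no prime divides both `Δ(W₀)` and `c₄(W₀)`: at `p ∤ Δ` good
reduction, at `p ∣ Δ` (hence `p ∤ c₄`) multiplicative reduction (Silverman *AEC* VII.5.1 (a), (b);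
the equation is minimal at `p`). [cite: SilvermanAEC2009, VII.5 Prop. 5.1] -/
theorem isSemistableAt_of_forall_not_dvd [(W₀.baseChange ℚ).IsElliptic]
    (hss : ∀ p : ℕ, p.Prime → (p : ℤ) ∣ W₀.Δ → ¬ (p : ℤ) ∣ W₀.c₄) (v : HeightOneSpectrum ℤ) :
    (W₀.baseChange ℚ).IsSemistableAt v := by
  by_cases hΔ : (natGenerator v : ℤ) ∣ W₀.Δ
  · exact Or.inr (hasMultiplicativeReductionAt_of_dvd_of_not_dvd hΔ
      (hss _ (prime_natGenerator v) hΔ))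
  · exact Or.inl (hasGoodReductionAt_of_not_dvd hΔ)

/-- **`W₀ ⊗ ℚ` is semistable** when no prime divides both `Δ(W₀)` and `c₄(W₀)`.
[cite: SilvermanAEC2009, VII.5 Prop. 5.1] -/
theorem isSemistable_of_forall_not_dvd [(W₀.baseChange ℚ).IsElliptic]
    (hss : ∀ p : ℕ, p.Prime → (p : ℤ) ∣ W₀.Δ → ¬ (p : ℤ) ∣ W₀.c₄) :
    (W₀.baseChange ℚ).IsSemistable ℤ :=
  fun v ↦ isSemistableAt_of_forall_not_dvd hss v

/-- **The conductor of such a `W₀ ⊗ ℚ` is squarefree** (semistable ⇔ squarefree conductor,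
Silverman *ATAEC* IV.10.2; tree `isSemistable_iff_squarefree_conductorNorm`).
[cite: Silverman1994, IV.10.2] -/
theorem squarefree_conductorNorm_of_forall_not_dvd [(W₀.baseChange ℚ).IsElliptic]
    (hss : ∀ p : ℕ, p.Prime → (p : ℤ) ∣ W₀.Δ → ¬ (p : ℤ) ∣ W₀.c₄) :
    Squarefree ((W₀.baseChange ℚ).conductorNorm ℤ) :=
  ((W₀.baseChange ℚ).isSemistable_iff_squarefree_conductorNorm).mp
    (isSemistable_of_forall_not_dvd hss)

/-- Such a `W₀ ⊗ ℚ` has **no additive place** (so the junk branches of `localRootNumber` at `2, 3`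
are never met). [cite: SilvermanAEC2009, VII.5 Prop. 5.1] -/
theorem not_hasAdditiveReductionAt_of_forall_not_dvd [(W₀.baseChange ℚ).IsElliptic]
    (hss : ∀ p : ℕ, p.Prime → (p : ℤ) ∣ W₀.Δ → ¬ (p : ℤ) ∣ W₀.c₄) (v : HeightOneSpectrum ℤ) :
    ¬ (W₀.baseChange ℚ).HasAdditiveReductionAt v := by
  refine not_hasAdditiveReductionAt_of_not_dvd_or ?_
  by_cases hΔ : (natGenerator v : ℤ) ∣ W₀.Δ
  · exact Or.inr (hss _ (prime_natGenerator v) hΔ)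
  · exact Or.inl hΔ

/-! ### §4 The algebraic root number as a finite product over the primes of `Δ` -/

/-- **`−∏ᵥ w_v(W₀ ⊗ ℚ) = −∏_{p ∣ Δ} s_p(W₀)`** for an integer equation with no prime dividing both `Δ`
and `c₄`: the local sign is `1` off `Δ`, and at `p ∣ Δ` it is the EXPLICIT sign
`s_2 = −1` iff `2 ∣ 54b₆ − 3b₂b₄ + a₂c₄` (else `+1`), `s_p = −J(−c₄c₆ | p)` for odd `p`.
[cite: Rohrlich1993Compositio, Prop. 2] [cite: KellockDokchitser2023, Def. 2.1] -/
theorem algebraicRootNumber_eq_neg_prod_primeFactors (hΔ0 : W₀.Δ ≠ 0)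
    (hss : ∀ p : ℕ, p.Prime → (p : ℤ) ∣ W₀.Δ → ¬ (p : ℤ) ∣ W₀.c₄) :
    (W₀.baseChange ℚ).algebraicRootNumber =
      -∏ p ∈ W₀.Δ.natAbs.primeFactors,
        (if p = 2 then (if (2 : ℤ) ∣ 54 * W₀.b₆ - 3 * W₀.b₂ * W₀.b₄ + W₀.a₂ * W₀.c₄ then -1 else 1)
         else -J(-(W₀.c₄ * W₀.c₆) | p)) := by
  haveI := WeierstrassCurve.isElliptic_baseChange_int W₀ hΔ0
  unfold WeierstrassCurve.algebraicRootNumber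
  congr 1
  rw [finprod_eq_prod_map_natPlace _ W₀.Δ.natAbs.primeFactors.toList (Finset.nodup_toList _)
      (fun p hp ↦ Nat.prime_of_mem_primeFactors (Finset.mem_toList.mp hp)) ?_,
    Finset.prod_map_toList]
  · refine Finset.prod_congr rfl fun p hp ↦ ?_
    have hp' : p.Prime := Nat.prime_of_mem_primeFactors hp
    have hpd : (p : ℤ) ∣ W₀.Δ := Int.natCast_dvd.mpr (Nat.dvd_of_mem_primeFactors hp)
    have hgen : natGenerator (natPlace p) = p := natGenerator_natPlace hp'
    have hΔ : (natGenerator (natPlace p) : ℤ) ∣ W₀.Δ := by rw [hgen]; exact hpd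
    have hc₄ : ¬ (natGenerator (natPlace p) : ℤ) ∣ W₀.c₄ := by rw [hgen]; exact hss p hp' hpd
    by_cases h2 : p = 2
    · rw [if_pos h2, localRootNumberAt_two_eq hΔ hc₄ (hgen.trans h2)]
    · rw [if_neg h2, localRootNumberAt_eq_neg_jacobiSym hΔ hc₄ (by rwa [hgen]), hgen]
  · intro v hv
    refine localRootNumberAt_eq_one_of_not_dvd fun hd ↦ hv ?_
    rw [Finset.mem_toList, Nat.mem_primeFactors]
    exact ⟨prime_natGenerator v, Int.natCast_dvd.mp hd, Int.natAbs_ne_zero.mpr hΔ0⟩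

/-! ### §5 The analytic root number (modulo the Modularity Theorem only) -/

/-- **`w(W₀ ⊗ ℚ) = −∏ᵥ w_v`** for an integer equation with no prime dividing both `Δ` and `c₄`, GIVEN the
Modularity Theorem `exists_isNewformOf`: squarefree conductor ⇒ the tree's PROVED
`rootNumber_eq_algebraicRootNumber_of_squarefree` (Atkin–Lehner signs at squarefree level,
Kellock–Dokchitser 2023 Cor. 2.5), whose guard «no additive place above `2, 3`» is vacuous here.
[cite: KellockDokchitser2023, Cor. 2.5] [cite: BCDTJAMS2001, Thm. A] -/
theorem rootNumber_eq_algebraicRootNumber_of_forall_not_dvd (hΔ0 : W₀.Δ ≠ 0)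
    (hss : ∀ p : ℕ, p.Prime → (p : ℤ) ∣ W₀.Δ → ¬ (p : ℤ) ∣ W₀.c₄)
    (hmod : Literature.NumberTheory.EllipticCurves.ModularForms.exists_isNewformOf) :
    (W₀.baseChange ℚ).rootNumber = (W₀.baseChange ℚ).algebraicRootNumber := by
  haveI := WeierstrassCurve.isElliptic_baseChange_int W₀ hΔ0
  exact WeierstrassCurve.rootNumber_eq_algebraicRootNumber_of_squarefree _
    (squarefree_conductorNorm_of_forall_not_dvd hss) hmod
    (fun v hv ↦ absurd hv (not_hasAdditiveReductionAt_of_forall_not_dvd hss v))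

/-- **Closed form of the root number of a semistable integer equation** (modulo Modularity):
`w(W₀ ⊗ ℚ) = −∏_{p ∣ Δ} s_p(W₀)` with the explicit signs of
`algebraicRootNumber_eq_neg_prod_primeFactors`. [cite: Rohrlich1993Compositio, Prop. 2]
[cite: KellockDokchitser2023, Cor. 2.5] -/
theorem rootNumber_eq_neg_prod_primeFactors (hΔ0 : W₀.Δ ≠ 0)
    (hss : ∀ p : ℕ, p.Prime → (p : ℤ) ∣ W₀.Δ → ¬ (p : ℤ) ∣ W₀.c₄)
    (hmod : Literature.NumberTheory.EllipticCurves.ModularForms.exists_isNewformOf) :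
    (W₀.baseChange ℚ).rootNumber =
      -∏ p ∈ W₀.Δ.natAbs.primeFactors,
        (if p = 2 then (if (2 : ℤ) ∣ 54 * W₀.b₆ - 3 * W₀.b₂ * W₀.b₄ + W₀.a₂ * W₀.c₄ then -1 else 1)
         else -J(-(W₀.c₄ * W₀.c₆) | p)) := by
  rw [rootNumber_eq_algebraicRootNumber_of_forall_not_dvd hΔ0 hss hmod,
    algebraicRootNumber_eq_neg_prod_primeFactors hΔ0 hss]

end Summit.BirchSwinnertonDyer.BirchSwinnertonDyer.Theorems.SemistableRootNumber

end
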